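import Literature.MathematicalPhysics.QuantumFieldTheory.Balaban1983to89.B2Ineq2109RegularField

/-!
# `Balaban1983to89.B2Eq2108FormSplit` — [Balaban1982Higgs2] **(2.108)** p. 580 for the CONCRETE covariant `Δ^{(k)}(Ω,B̃)`: the
# three localized terms of (2.108) ARE the quadratic forms of `Δ^{(k)}(Ω₁,B̃)`, `Δ^{(k)}(Ω₂,B^{(k+1),η})` on the regions' own
# unit sites (extension-by-zero matrices), the printed splitting `(2.108) = … + ½⟨Λ₆′φ, H_kΛ₆′φ⟩` EXACTLY, and a NON-VACUITY
# witness of the standing context `Adm` of `B2Ineq2109RegularField` with every block of (2.108) inhabited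

statement-level skeleton of published theorems with citation tags; proofs where landed; nothing here is a claim about the Yang–Mills mass gap

PDF held: `paper:balaban1982-cmp86-higgs23-ii` (T. Bałaban, *(Higgs)₂,₃ quantum fields in a finite volume. II. An upper
bound*, Commun. Math. Phys. **86** (1982) 555–594 [Balaban1982Higgs2]; journal page = PDF page + 554); p. 580 [PDF 26] READ
AS AN IMAGE on `run/shared/lean/pub/pub-balaban/b2b-balaban-ref1/pages/1982-cmp86-higgs23-II/1982-cmp86-higgs23-II-p026-x2.png`.

CITATION HEADER (lean-in-tree rule).  Cell `lit-balaban` (HOME `run/shared/lean/pub/lit-balaban/`), Phase-2 proof seat **p23**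
gen 7 (unit `lit-balaban-p23-g7`); SKELETON row **B2.Eq2.109** ((2.108)–(2.109) p. 580; fold owner r02, second reader r14,
referee ref-4); companion of `B2Ineq2109RegularField` (same seat, p260028: `Inst`, `Adm`, the operators `opΩ/op1/op2` =
p17's `B1Prop22RegularFieldAlg.deltaK` on `Ω, Ω₁, Ω₂`, the matrices `MΩ/MPP/MP34/M34P/M33` on `X = Λ₆^{(k−1)′} × {1,…,N}`,
`Hk`, `eq2108_split_printed`, and (2.109) `abs_hk_le` — all used BY NAME).  Nothing of another seat is restated.

WHAT IS PRINTED (p. 580 [PDF 26], verbatim).  *"We have ½aL^{d−2}Σ_{y∈T₁^{(k)′}}|ψ(y) − (Q(θ_kB̃)φ)(y)|² +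
½⟨(Λ₆^{(k−1)′}∩Λ₃^{(k)c})φ, Δ^{(k)}(B^k(Λ₂^{(k−1)′}∩Λ₅^{(k)c}), B̃)(Λ₆^{(k−1)′}∩Λ₃^{(k)c})φ⟩ + ⟨(Λ₆^{(k−1)′}∩Λ₃^{(k)c})φ,
Δ^{(k)}(B^k(Λ₂^{(k−1)′}∩Λ₅^{(k)c}), B̃)(Λ₃^{(k)}∩Λ₄^{(k)c})φ⟩ + ⟨Λ₃^{(k)}φ, Δ^{(k)}(B^k(Λ₂^{(k)}), B^{(k+1),η})Λ₃^{(k)}φ⟩ +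
O((Lᵏε)^κ)|Λ₃^{(k)}|.  (2.108)  More exactly the difference between the quadratic forms is a quadratic form ½⟨Λ₆^{(k−1)′}φ,
H_kΛ₆^{(k−1)′}φ⟩ …"* (the form being localized is the basic quadratic form in `φ`, `½⟨Λ₆^{(k−1)′}φ, Δ^{(k)}(B^k(Λ₂^{(k−1)′}),
B̃)Λ₆^{(k−1)′}φ⟩`, p. 579–580).

DICTIONARY (print ↦ Lean; as in `B2Ineq2109RegularField`).  `E6 ι i`, `EP ι i`, `E34 ι i`, `E3 ι i` ↤ the extensions by zero
of `Λ₆′φ`, `(Λ₆′∩Λ₃ᶜ)φ`, `(Λ₃∩Λ₄ᶜ)φ`, `Λ₃φ` from `X` to the unit sites of `Ω`, `Ω₁`, `Ω₁`, `Ω₂` (0/1 matrices; `E6_mulVec_apply`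
etc. say what they do pointwise); the printed pairings `⟨u, Δ^{(k)}(·)v⟩` ↤ `u ⬝ᵥ (op *ᵥ v)` (counting pairing on unit sites ×
colours, as in p17's dictionary).

WHAT IS KERNEL-CHECKED (zero `sorry`, no new `def … : Prop`; axioms standard).
 §1 `colsum_E6/EP/E34/E3` (column sums of the extension matrices pick the point, or vanish off the indicator set).
 §2 **`MΩ_eq : MΩ = E₆ᵀ·Δ^{(k)}(Ω,B̃)·E₆`**, **`MPP_eq : MPP = E_Pᵀ·Δ^{(k)}(Ω₁,B̃)·E_P`**, **`MP34_eq : MP34 = E_Pᵀ·Δ^{(k)}(Ω₁,B̃)·E₃₄`**,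
    **`M33_eq : M33 = E₃ᵀ·Δ^{(k)}(Ω₂,B^{(k+1),η})·E₃`** — the matrices of the companion file ARE the printed localized operators.
 §3 `form_MΩ/form_MPP/form_MP34/form_M33` (the forms), **`eq2108`**: `½⟨E₆φ, Δ(Ω)E₆φ⟩ = ½⟨E_Pφ, Δ(Ω₁)E_Pφ⟩ + ⟨E_Pφ, Δ(Ω₁)E₃₄φ⟩ +
    ½⟨E₃φ, Δ(Ω₂)E₃φ⟩ + ½⟨φ, H_kφ⟩` EXACTLY — (2.108) with the printed first three terms and the error term identified as the form
    of `H_k` (whose kernel obeys (2.109), `B2Ineq2109RegularField.Inst.abs_hk_le`); `E6/EP/E34/E3_mulVec_apply`.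
 §4 **`Witness.adm_nonvacuous`**: for every window `a₋ ≤ a₊`, every `c ≥ 0`, `β`, `e₁ > 0` there is an admissible step
    (`Adm c β 1 e₁ i`) with `r = 2 > 0` and `P`, `Λ₃∖Λ₄`, `Λ₄`, `Λ₅`, `Ω∖Ω₂` all NONEMPTY (mesh 1, zero field, labels `0,2e₀,…,8e₀`)
    — so (2.109)'s admissible family is not vacuous and every block of `H_k` occurs.

HONEST SCOPE.  (a) Exact algebra only: this file identifies the three localized terms and the splitting; the SIZE
`O((Lᵏε)^κ)|Λ₃^{(k)}|` of `½⟨Λ₆′φ, H_kΛ₆′φ⟩` under the restrictions on `φ` is NOT proved here (it needs the `x`-dependent damping of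
the kernel bound and lattice sums — a further companion), only its kernel statement (2.109) (companion file).  (b) The first
term of (2.108) (the `ψ`-form) is untouched by the localization and not modelled.  (c) The witness of §4 is a toy geometry (one
axis, mesh 1, `M = 1`, `A = 0`); it certifies satisfiability of `Adm` with all blocks inhabited, nothing about the sets actually
produced by (2.7)–(2.8).  (d) Value = kernel certificate of the bookkeeping of (2.108) for the lineage's concrete operators;
NOT summit progress.
-/

namespace Literature.MathematicalPhysics.QuantumFieldTheory.Balaban1983to89.B2Eq2108FormSplit

open Finset Matrix
open Literature.MathematicalPhysics.QuantumFieldTheory.Balaban1983to89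
open Literature.MathematicalPhysics.QuantumFieldTheory.Balaban1983to89.B4GaugeCovariance (OrthFlow)
open Literature.MathematicalPhysics.QuantumFieldTheory.Balaban1983to89.B4Lower18 (fineDom mem_fineDom IsBlockUnion
  fineDom_isBlockUnion)
open Literature.MathematicalPhysics.QuantumFieldTheory.Balaban1983to89.B4Lower18Regular (e1)
open Literature.MathematicalPhysics.QuantumFieldTheory.Balaban1983to89.B4ContourShift (supNorm supNorm_nonneg
  abs_le_supNorm exists_supNorm_eq)
open Literature.MathematicalPhysics.QuantumFieldTheory.Balaban1983to89.B4Reflection242 (supNorm_le_of_forall)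
open Literature.MathematicalPhysics.QuantumFieldTheory.Balaban1983to89.B2Ineq2109RegularField (Inst Adm AdmInst)

noncomputable section

variable {d : ℕ} {ι : Type} [Fintype ι] [DecidableEq ι]

namespace InstForms

open B2Ineq2109RegularField.Inst

variable {aminus aplus : ℝ} (i : Inst d aminus aplus) (F : OrthFlow ι)

/-! ## §1 The extension-by-zero matrices from `X = Λ₆^{(k−1)′} × {1,…,N}` to the unit sites of `Ω`, `Ω₁`, `Ω₂` -/

variable (ι) in
/-- `E₆`: `Λ₆′φ` as a configuration on the unit sites of `Ω = B^k(Λ₂^{(k−1)′})` (extension by zero).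
[cite: Balaban1982Higgs2, (2.108) p.580] -/
def E6 : Matrix (↥i.Ωc × ι) (↥i.L6 × ι) ℝ :=
  Matrix.of fun a p => if a.1.1 = p.1.1 ∧ a.2 = p.2 then 1 else 0

variable (ι) in
/-- `E_P`: `(Λ₆^{(k−1)′}∩Λ₃^{(k)c})φ` as a configuration on the unit sites of `Ω₁ = B^k(Λ₂^{(k−1)′}∩Λ₅^{(k)c})`.
[cite: Balaban1982Higgs2, (2.108) p.580] -/
def EP : Matrix (↥(i.Ωc \ i.L5) × ι) (↥i.L6 × ι) ℝ :=
  Matrix.of fun a p => if a.1.1 = p.1.1 ∧ a.2 = p.2 ∧ p.1.1 ∉ i.L3 then 1 else 0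

variable (ι) in
/-- `E₃₄`: `(Λ₃^{(k)}∩Λ₄^{(k)c})φ` as a configuration on the unit sites of `Ω₁`. [cite: Balaban1982Higgs2, (2.108) p.580] -/
def E34 : Matrix (↥(i.Ωc \ i.L5) × ι) (↥i.L6 × ι) ℝ :=
  Matrix.of fun a p => if a.1.1 = p.1.1 ∧ a.2 = p.2 ∧ (p.1.1 ∈ i.L3 ∧ p.1.1 ∉ i.L4) then 1 else 0

variable (ι) in
/-- `E₃`: `Λ₃^{(k)}φ` as a configuration on the unit sites of `Ω₂ = B^k(Λ₂^{(k)})`. [cite: Balaban1982Higgs2, (2.108) p.580] -/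
def E3 : Matrix (↥i.L2k × ι) (↥i.L6 × ι) ℝ :=
  Matrix.of fun a p => if a.1.1 = p.1.1 ∧ a.2 = p.2 ∧ p.1.1 ∈ i.L3 then 1 else 0

/-- a sum against a one-point indicator picks the point. [folklore] -/
private theorem sum_ite_eq_mul {α : Type} [Fintype α] [DecidableEq α] (a₀ : α) (P : α → Prop) [DecidablePred P]
    (hP : ∀ a, P a ↔ a = a₀) (g : α → ℝ) : ∑ a, (if P a then (1 : ℝ) else 0) * g a = g a₀ := by
  rw [Finset.sum_eq_single a₀]
  · rw [if_pos ((hP a₀).2 rfl), one_mul]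
  · intro a _ ha; rw [if_neg (fun h => ha ((hP a).1 h)), zero_mul]
  · intro h; exact absurd (Finset.mem_univ a₀) h

/-- column sums of `E₆`: `Σ_a E₆(a,p)g(a) = g(x,j)` for `p = (x,j)`, `x ∈ Λ₆′ ⊆ Ω^{(k)}`. [cite: Balaban1982Higgs2, (2.108) p.580] -/
theorem colsum_E6 (g : ↥i.Ωc × ι → ℝ) (p : ↥i.L6 × ι) :
    ∑ a, E6 ι i a p * g a = g (⟨p.1.1, i.h6 p.1.2⟩, p.2) := by
  unfold E6
  simp only [Matrix.of_apply]
  refine sum_ite_eq_mul _ _ (fun a => ?_) g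
  constructor
  · rintro ⟨h1, h2⟩; exact Prod.ext (Subtype.ext h1) h2
  · rintro rfl; exact ⟨rfl, rfl⟩

/-- column sums of `E_P`: `Σ_a E_P(a,p)g(a) = [x ∉ Λ₃]·g(x,j)`. [cite: Balaban1982Higgs2, (2.108) p.580] -/
theorem colsum_EP (g : ↥(i.Ωc \ i.L5) × ι → ℝ) (p : ↥i.L6 × ι) :
    ∑ a, EP ι i a p * g a = if h : p.1.1 ∉ i.L3 then
      g (⟨p.1.1, i.mem_sdiff_of p.1 (fun h5 => h (i.h43 (i.h54 h5)))⟩, p.2) else 0 := by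
  unfold EP
  simp only [Matrix.of_apply]
  by_cases h : p.1.1 ∉ i.L3
  · rw [dif_pos h]
    refine sum_ite_eq_mul _ _ (fun a => ?_) g
    constructor
    · rintro ⟨h1, h2, -⟩; exact Prod.ext (Subtype.ext h1) h2
    · rintro rfl; exact ⟨rfl, rfl, h⟩
  · rw [dif_neg h]
    refine Finset.sum_eq_zero fun a _ => ?_
    rw [if_neg (fun h' => h h'.2.2), zero_mul]

/-- column sums of `E₃₄`: `Σ_a E₃₄(a,p)g(a) = [x ∈ Λ₃∖Λ₄]·g(x,j)`. [cite: Balaban1982Higgs2, (2.108) p.580] -/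
theorem colsum_E34 (g : ↥(i.Ωc \ i.L5) × ι → ℝ) (p : ↥i.L6 × ι) :
    ∑ a, E34 ι i a p * g a = if h : p.1.1 ∈ i.L3 ∧ p.1.1 ∉ i.L4 then
      g (⟨p.1.1, i.mem_sdiff_of p.1 (fun h5 => h.2 (i.h54 h5))⟩, p.2) else 0 := by
  unfold E34
  simp only [Matrix.of_apply]
  by_cases h : p.1.1 ∈ i.L3 ∧ p.1.1 ∉ i.L4
  · rw [dif_pos h]
    refine sum_ite_eq_mul _ _ (fun a => ?_) g
    constructor
    · rintro ⟨h1, h2, -⟩; exact Prod.ext (Subtype.ext h1) h2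
    · rintro rfl; exact ⟨rfl, rfl, h⟩
  · rw [dif_neg h]
    refine Finset.sum_eq_zero fun a _ => ?_
    rw [if_neg (fun h' => h h'.2.2), zero_mul]

/-- column sums of `E₃`: `Σ_a E₃(a,p)g(a) = [x ∈ Λ₃]·g(x,j)`. [cite: Balaban1982Higgs2, (2.108) p.580] -/
theorem colsum_E3 (g : ↥i.L2k × ι → ℝ) (p : ↥i.L6 × ι) :
    ∑ a, E3 ι i a p * g a = if h : p.1.1 ∈ i.L3 then g (⟨p.1.1, i.h32 h⟩, p.2) else 0 := by
  unfold E3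
  simp only [Matrix.of_apply]
  by_cases h : p.1.1 ∈ i.L3
  · rw [dif_pos h]
    refine sum_ite_eq_mul _ _ (fun a => ?_) g
    constructor
    · rintro ⟨h1, h2, -⟩; exact Prod.ext (Subtype.ext h1) h2
    · rintro rfl; exact ⟨rfl, rfl, h⟩
  · rw [dif_neg h]
    refine Finset.sum_eq_zero fun a _ => ?_
    rw [if_neg (fun h' => h h'.2.2), zero_mul]

/-! ## §2 The matrices of (2.108) are the transported region operators -/

/-- generic: `(Eᵀ K E′)(p,q) = Σ_b E′(b,q)·(Σ_a E(a,p)K(a,b))`. [folklore] -/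
private theorem transpose_mul_mul_apply {A B : Type} [Fintype A] [Fintype B] (E E' : Matrix A B ℝ) (K : Matrix A A ℝ)
    (p q : B) : (Eᵀ * K * E') p q = ∑ b, E' b q * ∑ a, E a p * K a b := by
  simp only [Matrix.mul_apply, Matrix.transpose_apply, Finset.sum_mul]
  refine Finset.sum_congr rfl fun b _ => ?_
  rw [Finset.mul_sum]
  refine Finset.sum_congr rfl fun a _ => ?_
  ring

/-- **`Λ₆′Δ^{(k)}(Ω,B̃)Λ₆′ = E₆ᵀ Δ^{(k)}(Ω,B̃) E₆`**. [cite: Balaban1982Higgs2, (2.108) p.580] -/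
theorem MΩ_eq : i.MΩ F = ((E6 ι i)ᵀ : Matrix (↥i.L6 × ι) (↥i.Ωc × ι) ℝ) * i.opΩ F * E6 ι i := by
  ext p q
  rw [transpose_mul_mul_apply, colsum_E6]
  simp_rw [colsum_E6]
  rfl

/-- **the second term of (2.108)**: `MPP = E_Pᵀ Δ^{(k)}(Ω₁,B̃) E_P`. [cite: Balaban1982Higgs2, (2.108) p.580] -/
theorem MPP_eq : i.MPP F = ((EP ι i)ᵀ : Matrix (↥i.L6 × ι) (↥(i.Ωc \ i.L5) × ι) ℝ) * i.op1 F * EP ι i := by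
  ext p q
  rw [transpose_mul_mul_apply, colsum_EP]
  simp_rw [colsum_EP]
  simp only [MPP, Matrix.of_apply, D1]
  by_cases hq : q.1.1 ∉ i.L3 <;> by_cases hp : p.1.1 ∉ i.L3
  · have hp5 : p.1.1 ∉ i.L5 := fun h5 => hp (i.h43 (i.h54 h5))
    have hq5 : q.1.1 ∉ i.L5 := fun h5 => hq (i.h43 (i.h54 h5))
    rw [if_pos ⟨hp, hq⟩, dif_pos ⟨hp5, hq5⟩, dif_pos hq, dif_pos hp]
  · rw [if_neg (fun h => hp h.1), dif_pos hq, dif_neg hp]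
  · rw [if_neg (fun h => hq h.2), dif_neg hq]
  · rw [if_neg (fun h => hq h.2), dif_neg hq]

/-- **the third term of (2.108)** (right half): `MP34 = E_Pᵀ Δ^{(k)}(Ω₁,B̃) E₃₄`. [cite: Balaban1982Higgs2, (2.108) p.580] -/
theorem MP34_eq : i.MP34 F = ((EP ι i)ᵀ : Matrix (↥i.L6 × ι) (↥(i.Ωc \ i.L5) × ι) ℝ) * i.op1 F * E34 ι i := by
  ext p q
  rw [transpose_mul_mul_apply, colsum_E34]
  simp_rw [colsum_EP]
  simp only [MP34, Matrix.of_apply, D1]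
  by_cases hq : q.1.1 ∈ i.L3 ∧ q.1.1 ∉ i.L4 <;> by_cases hp : p.1.1 ∉ i.L3
  · have hp5 : p.1.1 ∉ i.L5 := fun h5 => hp (i.h43 (i.h54 h5))
    have hq5 : q.1.1 ∉ i.L5 := fun h5 => hq.2 (i.h54 h5)
    rw [if_pos ⟨hp, hq⟩, dif_pos ⟨hp5, hq5⟩, dif_pos hq, dif_pos hp]
  · rw [if_neg (fun h => hp h.1), dif_pos hq, dif_neg hp]
  · rw [if_neg (fun h => hq h.2), dif_neg hq]
  · rw [if_neg (fun h => hq h.2), dif_neg hq]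

/-- **the fourth term of (2.108)**: `M33 = E₃ᵀ Δ^{(k)}(Ω₂,B^{(k+1),η}) E₃`. [cite: Balaban1982Higgs2, (2.108) p.580] -/
theorem M33_eq : i.M33 F = ((E3 ι i)ᵀ : Matrix (↥i.L6 × ι) (↥i.L2k × ι) ℝ) * i.op2 F * E3 ι i := by
  ext p q
  rw [transpose_mul_mul_apply, colsum_E3]
  simp_rw [colsum_E3]
  simp only [M33, Matrix.of_apply, D2]
  by_cases hq : q.1.1 ∈ i.L3 <;> by_cases hp : p.1.1 ∈ i.L3
  · rw [if_pos ⟨hp, hq⟩, dif_pos ⟨hp, hq⟩, dif_pos hq, dif_pos hp]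
  · rw [if_neg (fun h => hp h.1), dif_pos hq, dif_neg hp]
  · rw [if_neg (fun h => hq h.2), dif_neg hq]
  · rw [if_neg (fun h => hq h.2), dif_neg hq]

/-- generic: `⟨φ, (EᵀKE′)φ⟩ = ⟨Eφ, K(E′φ)⟩`. [folklore] -/
private theorem form_transpose_mul_mul {A B : Type} [Fintype A] [Fintype B] (E E' : Matrix A B ℝ) (K : Matrix A A ℝ)
    (φ : B → ℝ) : φ ⬝ᵥ ((Eᵀ * K * E') *ᵥ φ) = (E *ᵥ φ) ⬝ᵥ (K *ᵥ (E' *ᵥ φ)) := by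
  rw [← Matrix.mulVec_mulVec, ← Matrix.mulVec_mulVec, Matrix.dotProduct_mulVec, Matrix.vecMul_transpose]

/-! ## §3 (2.108) as printed: the forms -/

/-- `⟨Λ₆′φ, Δ^{(k)}(B^k(Λ₂^{(k−1)′}),B̃)Λ₆′φ⟩` computed on `X` IS the form of `Δ^{(k)}(Ω,B̃)` at the extended configuration.
[cite: Balaban1982Higgs2, (2.108) p.580] -/
theorem form_MΩ (φ : ↥i.L6 × ι → ℝ) : φ ⬝ᵥ (i.MΩ F *ᵥ φ) = (E6 ι i *ᵥ φ) ⬝ᵥ (i.opΩ F *ᵥ (E6 ι i *ᵥ φ)) := by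
  rw [MΩ_eq, form_transpose_mul_mul]

/-- the second term: `⟨(Λ₆′∩Λ₃ᶜ)φ, Δ^{(k)}(Ω₁,B̃)(Λ₆′∩Λ₃ᶜ)φ⟩`. [cite: Balaban1982Higgs2, (2.108) p.580] -/
theorem form_MPP (φ : ↥i.L6 × ι → ℝ) : φ ⬝ᵥ (i.MPP F *ᵥ φ) = (EP ι i *ᵥ φ) ⬝ᵥ (i.op1 F *ᵥ (EP ι i *ᵥ φ)) := by
  rw [MPP_eq, form_transpose_mul_mul]

/-- the third term: `⟨(Λ₆′∩Λ₃ᶜ)φ, Δ^{(k)}(Ω₁,B̃)(Λ₃∩Λ₄ᶜ)φ⟩`. [cite: Balaban1982Higgs2, (2.108) p.580] -/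
theorem form_MP34 (φ : ↥i.L6 × ι → ℝ) : φ ⬝ᵥ (i.MP34 F *ᵥ φ) = (EP ι i *ᵥ φ) ⬝ᵥ (i.op1 F *ᵥ (E34 ι i *ᵥ φ)) := by
  rw [MP34_eq, form_transpose_mul_mul]

/-- the fourth term: `⟨Λ₃φ, Δ^{(k)}(B^k(Λ₂^{(k)}),B^{(k+1),η})Λ₃φ⟩`. [cite: Balaban1982Higgs2, (2.108) p.580] -/
theorem form_M33 (φ : ↥i.L6 × ι → ℝ) : φ ⬝ᵥ (i.M33 F *ᵥ φ) = (E3 ι i *ᵥ φ) ⬝ᵥ (i.op2 F *ᵥ (E3 ι i *ᵥ φ)) := by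
  rw [M33_eq, form_transpose_mul_mul]

/-- **(2.108) AS PRINTED, for the concrete `Δ^{(k)}(Ω,B̃)`**: `½⟨Λ₆′φ, Δ^{(k)}(B^k(Λ₂^{(k−1)′}),B̃)Λ₆′φ⟩ = ½⟨Pφ, Δ^{(k)}(Ω₁,B̃)Pφ⟩ +
⟨Pφ, Δ^{(k)}(Ω₁,B̃)(Λ₃∩Λ₄ᶜ)φ⟩ + ½⟨Λ₃φ, Δ^{(k)}(B^k(Λ₂^{(k)}),B^{(k+1),η})Λ₃φ⟩ + ½⟨Λ₆′φ, H_kΛ₆′φ⟩` EXACTLY (`P = Λ₆^{(k−1)′}∩Λ₃^{(k)c}`;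
the last term is the printed `O((Lᵏε)^κ)|Λ₃^{(k)}|`, whose kernel obeys (2.109) by `B2Ineq2109RegularField.Inst.abs_hk_le`).
[cite: Balaban1982Higgs2, (2.108) p.580] -/
theorem eq2108 (φ : ↥i.L6 × ι → ℝ) :
    (1 / 2 : ℝ) * ((E6 ι i *ᵥ φ) ⬝ᵥ (i.opΩ F *ᵥ (E6 ι i *ᵥ φ)))
      = (1 / 2 : ℝ) * ((EP ι i *ᵥ φ) ⬝ᵥ (i.op1 F *ᵥ (EP ι i *ᵥ φ)))
        + (EP ι i *ᵥ φ) ⬝ᵥ (i.op1 F *ᵥ (E34 ι i *ᵥ φ))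
        + (1 / 2 : ℝ) * ((E3 ι i *ᵥ φ) ⬝ᵥ (i.op2 F *ᵥ (E3 ι i *ᵥ φ)))
        + (1 / 2 : ℝ) * (φ ⬝ᵥ (i.Hk F *ᵥ φ)) := by
  rw [← form_MΩ, ← form_MPP, ← form_MP34, ← form_M33, eq2108_split_printed]
  ring

/-- what the extended configurations are, pointwise: `(E₆φ)(y,j) = φ(y,j)` for `y ∈ Λ₆′`, else `0`. [cite: Balaban1982Higgs2, (2.108) p.580] -/
theorem E6_mulVec_apply (φ : ↥i.L6 × ι → ℝ) (a : ↥i.Ωc × ι) :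
    (E6 ι i *ᵥ φ) a = if h : a.1.1 ∈ i.L6 then φ (⟨a.1.1, h⟩, a.2) else 0 := by
  simp only [Matrix.mulVec, dotProduct, E6, Matrix.of_apply]
  by_cases h : a.1.1 ∈ i.L6
  · rw [dif_pos h, Finset.sum_eq_single (⟨a.1.1, h⟩, a.2)]
    · simp
    · intro p _ hp
      rw [if_neg, zero_mul]
      rintro ⟨h1, h2⟩
      exact hp (Prod.ext (Subtype.ext h1.symm) h2.symm)
    · intro hh; exact absurd (Finset.mem_univ _) hh
  · rw [dif_neg h]
    refine Finset.sum_eq_zero fun p _ => ?_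
    rw [if_neg, zero_mul]
    rintro ⟨h1, -⟩
    exact h (h1 ▸ p.1.2)

/-- `(E_Pφ)(y,j) = φ(y,j)` for `y ∈ Λ₆′∩Λ₃ᶜ`, else `0`. [cite: Balaban1982Higgs2, (2.108) p.580] -/
theorem EP_mulVec_apply (φ : ↥i.L6 × ι → ℝ) (a : ↥(i.Ωc \ i.L5) × ι) :
    (EP ι i *ᵥ φ) a = if h : a.1.1 ∈ i.L6 ∧ a.1.1 ∉ i.L3 then φ (⟨a.1.1, h.1⟩, a.2) else 0 := by
  simp only [Matrix.mulVec, dotProduct, EP, Matrix.of_apply]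
  by_cases h : a.1.1 ∈ i.L6 ∧ a.1.1 ∉ i.L3
  · rw [dif_pos h, Finset.sum_eq_single (⟨a.1.1, h.1⟩, a.2)]
    · simp [h.2]
    · intro p _ hp
      rw [if_neg, zero_mul]
      rintro ⟨h1, h2, -⟩
      exact hp (Prod.ext (Subtype.ext h1.symm) h2.symm)
    · intro hh; exact absurd (Finset.mem_univ _) hh
  · rw [dif_neg h]
    refine Finset.sum_eq_zero fun p _ => ?_
    rw [if_neg, zero_mul]
    rintro ⟨h1, -, h3⟩
    exact h ⟨h1 ▸ p.1.2, h1 ▸ h3⟩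

/-- `(E₃₄φ)(y,j) = φ(y,j)` for `y ∈ Λ₃∩Λ₄ᶜ`, else `0`. [cite: Balaban1982Higgs2, (2.108) p.580] -/
theorem E34_mulVec_apply (φ : ↥i.L6 × ι → ℝ) (a : ↥(i.Ωc \ i.L5) × ι) :
    (E34 ι i *ᵥ φ) a = if h : a.1.1 ∈ i.L3 ∧ a.1.1 ∉ i.L4 then φ (⟨a.1.1, i.h36 h.1⟩, a.2) else 0 := by
  simp only [Matrix.mulVec, dotProduct, E34, Matrix.of_apply]
  by_cases h : a.1.1 ∈ i.L3 ∧ a.1.1 ∉ i.L4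
  · rw [dif_pos h, Finset.sum_eq_single (⟨a.1.1, i.h36 h.1⟩, a.2)]
    · simp [h.1, h.2]
    · intro p _ hp
      rw [if_neg, zero_mul]
      rintro ⟨h1, h2, -⟩
      exact hp (Prod.ext (Subtype.ext h1.symm) h2.symm)
    · intro hh; exact absurd (Finset.mem_univ _) hh
  · rw [dif_neg h]
    refine Finset.sum_eq_zero fun p _ => ?_
    rw [if_neg, zero_mul]
    rintro ⟨h1, -, h3⟩
    exact h (h1 ▸ h3)

/-- `(E₃φ)(y,j) = φ(y,j)` for `y ∈ Λ₃`, else `0`. [cite: Balaban1982Higgs2, (2.108) p.580] -/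
theorem E3_mulVec_apply (φ : ↥i.L6 × ι → ℝ) (a : ↥i.L2k × ι) :
    (E3 ι i *ᵥ φ) a = if h : a.1.1 ∈ i.L3 then φ (⟨a.1.1, i.h36 h⟩, a.2) else 0 := by
  simp only [Matrix.mulVec, dotProduct, E3, Matrix.of_apply]
  by_cases h : a.1.1 ∈ i.L3
  · rw [dif_pos h, Finset.sum_eq_single (⟨a.1.1, i.h36 h⟩, a.2)]
    · simp [h]
    · intro p _ hp
      rw [if_neg, zero_mul]
      rintro ⟨h1, h2, -⟩
      exact hp (Prod.ext (Subtype.ext h1.symm) h2.symm)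
    · intro hh; exact absurd (Finset.mem_univ _) hh
  · rw [dif_neg h]
    refine Finset.sum_eq_zero fun p _ => ?_
    rw [if_neg, zero_mul]
    rintro ⟨h1, -, h3⟩
    exact h (h1 ▸ h3)

end InstForms

/-! ## §4 Non-vacuity of the standing context `Adm`

A witness with every block of (2.108) inhabited (`P`, `Λ₃∖Λ₄`, `Λ₄`, `Λ₅`, `Ω ∖ Ω₂` all nonempty) and `r > 0`: mesh `n = 1`,
big-block size `M = 1`, the zero field (regular for every `c ≥ 0`), unit labels on the first axis spaced `2` apart.
[cite: Balaban1982Higgs2, (2.108) p.580] -/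

namespace Witness

/-- the unit label `m·e₀` on the first axis. [folklore] -/
def ax (d : ℕ) (m : ℤ) : Fin (d + 1) → ℤ := fun j => if j = 0 then m else 0

/-- `|m·e₀ − m′·e₀|_∞ = |m − m′|`. [folklore] -/
private theorem supNorm_ax_sub (d : ℕ) (m m' : ℤ) : supNorm (ax d m - ax d m') = |((m : ℝ) - m')| := by
  have hj : ∀ j : Fin (d + 1), (ax d m - ax d m') j = if j = 0 then m - m' else 0 := by
    intro j; simp only [ax, Pi.sub_apply]; split_ifs <;> simp
  refine le_antisymm (supNorm_le_of_forall fun j => ?_) ?_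
  · rw [hj]; split_ifs <;> simp [abs_nonneg]
  · have h := abs_le_supNorm (ax d m - ax d m') 0
    rw [hj, if_pos rfl] at h
    simpa using h

/-- distinct multiples give distinct labels. [folklore] -/
private theorem ax_injective (d : ℕ) {m m' : ℤ} (h : ax d m = ax d m') : m = m' := by
  have := congrFun h 0
  simpa [ax] using this

/-- **`Adm` IS INHABITED with all blocks of (2.108) nonempty and `r = 2 > 0`** (mesh `1`, `M = 1`, zero field, labels
`0, 2e₀, 4e₀, 6e₀, 8e₀`: `Λ₅ = {0} ⊂ Λ₄ = {0,2e₀} ⊂ Λ₃ = {0,2e₀,4e₀} ⊂ Λ₆′ = Λ₂^{(k)} = {0,…,6e₀} ⊂ Λ₂′ = {0,…,8e₀}`), for every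
window, every `c ≥ 0`, `β`, and every charge threshold `e₁ > 0`. [cite: Balaban1982Higgs2, (2.108) p.580] -/
theorem adm_nonvacuous (d : ℕ) {aminus aplus : ℝ} (hle : aminus ≤ aplus) {c : ℝ} (hc : 0 ≤ c) (β : ℝ)
    {e₁ : ℝ} (he₁ : 0 < e₁) :
    ∃ i : Inst d aminus aplus, Adm c β 1 e₁ i ∧ 0 < i.r ∧ (i.L6 \ i.L3).Nonempty ∧ (i.L3 \ i.L4).Nonempty ∧
      i.L4.Nonempty ∧ i.L5.Nonempty ∧ (i.Ωc \ i.L2k).Nonempty := by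
  classical
  let A0 : (Fin (d + 1) → ℤ) → Fin (d + 1) → ℝ := fun _ _ => 0
  let i : Inst d aminus aplus :=
    { n := 1, hn := le_rfl, e := e₁, Ac := A0, m2 := 0, hm := le_rfl, ak := aminus, hak := le_rfl, hak' := hle,
      Ωc := {ax d 0, ax d 2, ax d 4, ax d 6, ax d 8}, L6 := {ax d 0, ax d 2, ax d 4, ax d 6},
      L3 := {ax d 0, ax d 2, ax d 4}, L4 := {ax d 0, ax d 2}, L5 := {ax d 0}, L2k := {ax d 0, ax d 2, ax d 4, ax d 6},
      h6 := by intro x hx; simp only [Finset.mem_insert, Finset.mem_singleton] at hx ⊢; tauto,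
      h36 := by intro x hx; simp only [Finset.mem_insert, Finset.mem_singleton] at hx ⊢; tauto,
      h43 := by intro x hx; simp only [Finset.mem_insert, Finset.mem_singleton] at hx ⊢; tauto,
      h54 := by intro x hx; simp only [Finset.mem_insert, Finset.mem_singleton] at hx ⊢; tauto,
      h32 := by intro x hx; simp only [Finset.mem_insert, Finset.mem_singleton] at hx ⊢; tauto,
      h2k := by intro x hx; simp only [Finset.mem_insert, Finset.mem_singleton] at hx ⊢; tauto,
      r := 2 }
  have hsep : ∀ m m' : ℤ, (2 : ℝ) ≤ |((m : ℝ) - m')| → (2 : ℝ) ≤ supNorm (ax d m - ax d m') := fun m m' h => by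
    rw [supNorm_ax_sub]; exact h
  have hne : ∀ m m' : ℤ, m ≠ m' → ax d m ≠ ax d m' := fun m m' h hx => h (ax_injective d hx)
  refine ⟨i, ⟨?_, ?_, ?_, ?_, he₁, le_rfl, by norm_num, ?_, ?_, ?_⟩, by norm_num, ?_, ?_, ?_, ?_, ?_⟩
  · -- regularity of the zero field
    intro x _ μ ν
    have hpow : (0 : ℝ) ≤ c * e₁ ^ (β - 1) / (1 : ℕ) := by
      have := Real.rpow_pos_of_pos he₁ (β - 1)
      positivity
    simpa [i, A0] using hpow
  · simpa [i] using fineDom_isBlockUnion (le_refl 1) i.Ωc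
  · simpa [i] using fineDom_isBlockUnion (le_refl 1) (i.Ωc \ i.L5)
  · simpa [i] using fineDom_isBlockUnion (le_refl 1) i.L2k
  · -- `sep45`: `x ∈ {4e₀, 6e₀}`, `u = 0`
    intro x hx hx4 u hu
    simp only [i, Finset.mem_insert, Finset.mem_singleton] at hx hx4 hu
    push Not at hx4
    rcases hx with rfl | rfl | rfl | rfl
    · exact absurd rfl hx4.1
    · exact absurd rfl hx4.2
    · subst hu; exact hsep 4 0 (by norm_num)
    · subst hu; exact hsep 6 0 (by norm_num)
  · -- `sep34`: `x = 6e₀`, `u ∈ {0, 2e₀}`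
    intro x hx hx3 u hu
    simp only [i, Finset.mem_insert, Finset.mem_singleton] at hx hx3 hu
    push Not at hx3
    rcases hx with rfl | rfl | rfl | rfl
    · exact absurd rfl hx3.1
    · exact absurd rfl hx3.2.1
    · exact absurd rfl hx3.2.2
    · rcases hu with rfl | rfl
      · exact hsep 6 0 (by norm_num)
      · exact hsep 6 2 (by norm_num)
  · -- `sep2k`: `x ∈ {0, 2e₀, 4e₀}`, `u = 8e₀`
    intro x hx u hu hu'
    simp only [i, Finset.mem_insert, Finset.mem_singleton] at hx hu hu'
    push Not at hu'
    rcases hu with rfl | rfl | rfl | rfl | rfl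
    · exact absurd rfl hu'.1
    · exact absurd rfl hu'.2.1
    · exact absurd rfl hu'.2.2.1
    · exact absurd rfl hu'.2.2.2
    · rcases hx with rfl | rfl | rfl
      · exact hsep 0 8 (by norm_num)
      · exact hsep 2 8 (by norm_num)
      · exact hsep 4 8 (by norm_num)
  · refine ⟨ax d 6, Finset.mem_sdiff.2 ⟨by simp [i], ?_⟩⟩
    simp only [i, Finset.mem_insert, Finset.mem_singleton, not_or]
    exact ⟨hne 6 0 (by norm_num), hne 6 2 (by norm_num), hne 6 4 (by norm_num)⟩
  · refine ⟨ax d 4, Finset.mem_sdiff.2 ⟨by simp [i], ?_⟩⟩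
    simp only [i, Finset.mem_insert, Finset.mem_singleton, not_or]
    exact ⟨hne 4 0 (by norm_num), hne 4 2 (by norm_num)⟩
  · exact ⟨ax d 0, by simp [i]⟩
  · exact ⟨ax d 0, by simp [i]⟩
  · refine ⟨ax d 8, Finset.mem_sdiff.2 ⟨by simp [i], ?_⟩⟩
    simp only [i, Finset.mem_insert, Finset.mem_singleton, not_or]
    exact ⟨hne 8 0 (by norm_num), hne 8 2 (by norm_num), hne 8 4 (by norm_num), hne 8 6 (by norm_num)⟩

end Witness

end

end Literature.MathematicalPhysics.QuantumFieldTheory.Balaban1983to89.B2Eq2108FormSplit
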